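import Literature.NumberTheory.Transcendental.L2HodgeTheory
import Literature.Geometry.Kaehler.RiemannianHodgeStarLaplacianProofs
import Literature.Geometry.Kaehler.RiemannianHodgeRoughMetric
import HarnessLib

/-!
# `⋆` preserves harmonic forms: status of the named fact `hodgeStar_mem_harmonicForms`

Companion of `Literature/NumberTheory/Transcendental/L2HodgeTheory.lean`, §*Hodge star and
harmonic forms: Poincaré duality (Warner 6.13)*, and of
`Literature/Geometry/Kaehler/RiemannianHodgeStarLaplacianProofs.lean` (`Δ⋆ = ⋆Δ`,
`IsHarmonicForm.hodgeStar`, `hodgeStar_mem_harmonicForms_of_mem`).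

## What the source says

F. W. Warner, *Foundations of Differentiable Manifolds and Lie Groups*, GTM 94 (1983): 6.1 (4),
p. 221 — "it is a straightforward exercise to check that the Laplacian commutes with `*`, that
is, `*Δ = Δ*`"; proof of Thm. 6.13 (Poincaré duality), p. 226 — "Since `*Δ = Δ*`, it follows
that `*φ` is also harmonic". Throughout Ch. 6 the metric is `C^∞` (and `M` compact oriented,
which this particular step does not use). (The docstring of the fact says "Cor. 6.13"; in Warner
6.13 is the *Theorem*, its Corollary being `Hⁿ_{deR}(M) ≅ ℝ`.)

## Status of `Literature.NumberTheory.Transcendental.hodgeStar_mem_harmonicForms` (misstated)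

The fact is a `def … : Prop` in `section Closed` of `L2HodgeTheory.lean`, whose instance
variables `[IsManifold I ∞ M]`, `[CompactSpace M]`, `[I.Boundaryless]`,
`[IsContinuousRiemannianBundle E (TangentSpace I)]`, `[IsContMDiffRiemannianBundle I ∞ E
(TangentSpace I)]` are *not mentioned in its body* and therefore — a `def` abstracts only the
section variables it uses — are **not hypotheses of the fact**: `#check
@hodgeStar_mem_harmonicForms` lists `[RiemannianBundle (TangentSpace I)]`, Mathlib's fibrewise
inner product *of no regularity in the base point*, as the only assumption on the metric (the
same M5 defect as `isSmoothForm_hodgeStar` and `mem_harmonicForms_iff` of `RiemannianHodge.lean`,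
see `RiemannianHodgeRoughMetric.lean`). In that generality the statement is **false**, so
`hodgeStar_mem_harmonicForms_holds` can never be proved:

* `roughMetric_not_hodgeStar_mem_harmonicForms`, `not_forall_hodgeStar_mem_harmonicForms`: for
  the rough metric `g = a dx² + a⁻¹ dy²` on `ℝ × ℝ` of `RiemannianHodgeRoughMetric.lean`
  (`a = exp ∘ switch ∘ fst` differentiable nowhere, `det g = 1`, so `vol = dx ∧ dy` is smooth
  and the hypothesis `ho` holds) the constant `1`-form `dy` is smooth and (junk-)harmonic:
  `d(dy) = 0`, while `⋆dy = -a dx` is differentiable nowhere, so the `fderiv`-based `d` returns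
  the junk value `d⋆dy = 0`, whence `δ dy = 0` and `Δ dy = 0` (`isHarmonicForm_roughMetricDy`).
  But `⋆dy = -a dx` is not smooth, whereas every element of `harmonicForms` — a span of smooth
  forms — is smooth (`isSmoothForm_of_mem_harmonicForms`). Degrees `k = m = 1`, `n = 2`.

What is true, and proved here:

* `hodgeStar_mem_harmonicForms_of_contMDiffMetric`: in the presence of the *intended* instances
  (`IsManifold I ∞ M`, smooth metric `IsContMDiffRiemannianBundle I ∞`) the fact as declared
  holds in every degree — the bridge to feed any consumer `(h : hodgeStar_mem_harmonicForms o)`.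
* `hodgeStar_mem_harmonicForms_of_isContMDiffRiemannianBundle` (named fact, the **corrected
  closed statement**, intended hypotheses bound inside, exactly as for
  `isSmoothForm_hodgeStar_of_isContMDiffRiemannianBundle`) and its discharge `…_holds`.
* `harmonicFormsHodgeStarEquiv`: for a smooth metric `⋆` restricts to a linear isomorphism
  `Hᵏ ≃ₗ[ℝ] Hᵐ` (`⋆⋆ = ±1` and `⋆Hᵏ = Hᵐ`, `map_hodgeStar_harmonicForms`), whence
  `finrank_harmonicForms_eq_of_contMDiffMetric`: the sibling named fact `finrank_harmonicForms_eq o`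
  (`dim Hᵏ = dim H^{n-k}`, same dropped instances) holds under the intended instances.

The first two are immediate from `Literature.Geometry.Kaehler.hodgeStar_mem_harmonicForms_of_mem`
(`RiemannianHodgeStarLaplacianProofs.lean`): `⋆` is linear, `⋆α` is smooth for smooth `α` and a
smooth metric (`IsSmoothForm.hodgeStar`, Warner 4.10 (6)), and `Δ⋆α = ⋆Δα = 0`
(`hodgeLaplacian_hodgeStar`, Warner 6.1 (4), pure algebra). Compactness, `Boundaryless` and
`IsContinuousRiemannianBundle` are not needed and not assumed. Following D-0014 the original def
is left untouched (it has no consumers).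

## References

* F. W. Warner, *Foundations of Differentiable Manifolds and Lie Groups*, GTM 94, Springer
  (1983): 6.1 (4), p. 221; Thm. 6.13 (proof), p. 226; 4.10 (6), p. 150.

## Verdict clean-up note (2026-08-15)

The named facts `finrank_harmonicForms_eq`, `hodgeStar_mem_harmonicForms` are now `@[deprecated]`
records of `L2HodgeTheory.lean` (mis-stated, resp. refuted as stated: a `def` does not abstract the
unused section instances it was written under; the corrected statements are the ones proved or named
in this file and in the records' docstrings). The declarations
`hodgeStar_mem_harmonicForms_of_contMDiffMetric`, `finrank_harmonicForms_eq_of_contMDiffMetric`,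
`roughMetric_not_hodgeStar_mem_harmonicForms`, `not_forall_hodgeStar_mem_harmonicForms` name the
records on purpose, so `linter.deprecated` is silenced on exactly those declarations (REMOVE-WHEN
the records are deleted from `L2HodgeTheory.lean`).
-/

noncomputable section

open scoped Manifold ContDiff Topology
open Bundle Module

namespace Literature.NumberTheory.Transcendental

open Literature.Geometry.Kaehler

/-! ### The fact under its intended hypotheses -/

section Bridge

variable {E : Type*} [NormedAddCommGroup E] [NormedSpace ℝ E] {n : ℕ} [Fact (finrank ℝ E = n)]
  {H : Type*} [TopologicalSpace H] {I : ModelWithCorners ℝ E H}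
  {M : Type*} [TopologicalSpace M] [ChartedSpace H M] [IsManifold I ∞ M] [FiniteDimensional ℝ E]
  [RiemannianBundle (fun x : M ↦ TangentSpace I x)]
  [IsContMDiffRiemannianBundle I ∞ E (fun x : M ↦ TangentSpace I x)] {k m : ℕ}
  (o : (x : M) → Orientation ℝ (TangentSpace I x) (Fin n))

-- names the `@[deprecated]` record `hodgeStar_mem_harmonicForms` on purpose (verdict clean-up 2026-08-15); REMOVE-WHEN the
-- record is deleted from `L2HodgeTheory.lean`
set_option linter.deprecated false in
/-- **Bridge to the named fact as declared.** In the presence of the intended instances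
(`IsManifold I ∞ M`, smooth metric `IsContMDiffRiemannianBundle I ∞`), the over-general named
fact `hodgeStar_mem_harmonicForms o` of `L2HodgeTheory.lean` holds in every degree: `⋆` maps
`harmonicForms o h` into the harmonic `m`-forms (`hodgeStar_mem_harmonicForms_of_mem`: `⋆` is
linear, `⋆α` is smooth for a smooth metric, and `Δ⋆ = ⋆Δ`). Warner (1983), 6.1 (4), p. 221 and
Thm. 6.13 (proof), p. 226. [cite: WarnerGTM94, Thm. 6.13 (proof), p. 226] -/
theorem hodgeStar_mem_harmonicForms_of_contMDiffMetric :
    hodgeStar_mem_harmonicForms (k := k) (m := m) o :=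
  fun ho h _ hα ↦ hodgeStar_mem_harmonicForms_of_mem o ho h _ hα

/-- **`⋆ : Hᵏ ≃ H^{n-k}`** for a smooth metric (orientation family with smooth volume form): the
Hodge star restricts to a linear isomorphism between the spaces of harmonic `k`-forms and of
harmonic `m`-forms (`k + m = n`). It is injective on all `k`-forms by `⋆⋆ = (-1)^{km}`
(`MForm.hodgeStar_hodgeStar_holds`, Warner (1983), 6.1 (1), p. 220) and maps `Hᵏ` onto `Hᵐ`
(`map_hodgeStar_harmonicForms`, from `*Δ = Δ*`, 6.1 (4)); this is the harmonic-forms content of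
Warner's proof of Poincaré duality, Thm. 6.13, p. 226. Built as
`Submodule.equivMapOfInjective` followed by `LinearEquiv.ofEq`.
[cite: WarnerGTM94, Thm. 6.13 (proof), p. 226] -/
def harmonicFormsHodgeStarEquiv (ho : IsSmoothForm (riemannianVolumeForm o)) (h : k + m = n)
    (h' : m + k = n) : ↥(harmonicForms o h) ≃ₗ[ℝ] ↥(harmonicForms o h') :=
  (Submodule.equivMapOfInjective (MForm.hodgeStar o h)
      (fun α β hαβ ↦ by
        have hc : ((-1 : ℝ) ^ (k * m)) ≠ 0 := pow_ne_zero _ (neg_ne_zero.2 one_ne_zero)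
        have h2 := congrArg (MForm.hodgeStar o h') hαβ
        rw [MForm.hodgeStar_hodgeStar_holds o h h' α, MForm.hodgeStar_hodgeStar_holds o h h' β]
          at h2
        exact smul_right_injective _ hc h2)
      (harmonicForms o h)).trans
    (LinearEquiv.ofEq _ _ (map_hodgeStar_harmonicForms o ho h h'))

/-- The harmonic-forms isomorphism `harmonicFormsHodgeStarEquiv` acts by the Hodge star.
[folklore] -/
@[simp]
theorem coe_harmonicFormsHodgeStarEquiv_apply (ho : IsSmoothForm (riemannianVolumeForm o))
    (h : k + m = n) (h' : m + k = n) (α : harmonicForms o h) :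
    (harmonicFormsHodgeStarEquiv o ho h h' α : MForm I M ℝ m) = MForm.hodgeStar o h α :=
  rfl

-- names the `@[deprecated]` record `finrank_harmonicForms_eq` on purpose (verdict clean-up 2026-08-15); REMOVE-WHEN the
-- record is deleted from `L2HodgeTheory.lean`
set_option linter.deprecated false in
/-- **Poincaré duality for harmonic spaces, for a smooth metric**: in the presence of the
intended instances (`IsManifold I ∞ M`, `IsContMDiffRiemannianBundle I ∞`) the named fact
`finrank_harmonicForms_eq o` of `L2HodgeTheory.lean` (`dim Hᵏ = dim H^{n-k}`; it drops the same
section instances as `hodgeStar_mem_harmonicForms`) holds as declared, by the linear isomorphism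
`harmonicFormsHodgeStarEquiv` (`LinearEquiv.finrank_eq`; no finite-dimensionality or compactness
is needed for this equality of `finrank`s). Warner (1983), Thm. 6.13 (proof), p. 226.
[cite: WarnerGTM94, Thm. 6.13 (proof), p. 226] -/
theorem finrank_harmonicForms_eq_of_contMDiffMetric :
    finrank_harmonicForms_eq (k := k) (m := m) o :=
  fun ho h ↦ (harmonicFormsHodgeStarEquiv o ho h _).finrank_eq

end Bridge

/-! ### The corrected named fact -/

section CorrectedFact

/-- **Corrected statement of the named fact
`Literature.NumberTheory.Transcendental.hodgeStar_mem_harmonicForms`** (`L2HodgeTheory.lean`).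
On a Riemannian manifold with *smooth* metric and an orientation family `o` with smooth volume
form, the Hodge star maps the space `Hᵏ` of harmonic `k`-forms into `H^{n-k}`: "Since `*Δ = Δ*`,
it follows that `*φ` is also harmonic" (Warner (1983), proof of Thm. 6.13, p. 226, with 6.1 (4),
p. 221: `*Δ = Δ*`).

Discrepancy with the original: `def hodgeStar_mem_harmonicForms` sits in a section whose
instance variables `[IsManifold I ∞ M]`, `[CompactSpace M]`, `[I.Boundaryless]`,
`[IsContinuousRiemannianBundle E (TangentSpace I)]`, `[IsContMDiffRiemannianBundle I ∞ E
(TangentSpace I)]` are not used in its body and are therefore not hypotheses of the fact, which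
thus quantifies over every fibrewise family of inner products (`Bundle.RiemannianBundle`, no
regularity in the base point) and is false in that generality
(`not_forall_hodgeStar_mem_harmonicForms` below: for the rough metric `a dx² + a⁻¹ dy²` on `ℝ²`
the smooth form `dy` is junk-harmonic but `⋆dy = -a dx` is not smooth). Here the intended
hypotheses `[IsManifold I ∞ M]` and `[IsContMDiffRiemannianBundle I ∞ E (TangentSpace I)]` are
bound inside a closed statement; compactness and `Boundaryless` (Warner's standing assumptions in
Ch. 6) are not used by this step and not assumed. Discharged by
`hodgeStar_mem_harmonicForms_of_isContMDiffRiemannianBundle_holds`; the usable forms are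
`Literature.Geometry.Kaehler.hodgeStar_mem_harmonicForms_of_mem`,
`Literature.Geometry.Kaehler.IsHarmonicForm.hodgeStar` and, for the fact as declared under the
intended instances, `hodgeStar_mem_harmonicForms_of_contMDiffMetric`.
[cite: WarnerGTM94, Thm. 6.13 (proof), p. 226] -/
def hodgeStar_mem_harmonicForms_of_isContMDiffRiemannianBundle : Prop :=
  ∀ {E : Type*} [NormedAddCommGroup E] [NormedSpace ℝ E] {n : ℕ} [Fact (finrank ℝ E = n)]
    {H : Type*} [TopologicalSpace H] {I : ModelWithCorners ℝ E H}
    {M : Type*} [TopologicalSpace M] [ChartedSpace H M] [IsManifold I ∞ M]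
    [FiniteDimensional ℝ E] [RiemannianBundle (fun x : M ↦ TangentSpace I x)]
    [IsContMDiffRiemannianBundle I ∞ E (fun x : M ↦ TangentSpace I x)] {k m : ℕ}
    (o : (x : M) → Orientation ℝ (TangentSpace I x) (Fin n)),
    IsSmoothForm (riemannianVolumeForm o) → ∀ (h : k + m = n) {α : MForm I M ℝ k},
      α ∈ harmonicForms o h → MForm.hodgeStar o h α ∈ harmonicForms o (show m + k = n by omega)

/-- **Discharge** of `hodgeStar_mem_harmonicForms_of_isContMDiffRiemannianBundle` (the corrected
form of the named fact `hodgeStar_mem_harmonicForms`): immediate from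
`Literature.Geometry.Kaehler.hodgeStar_mem_harmonicForms_of_mem` (`⋆` linear, `⋆α` smooth by
`IsSmoothForm.hodgeStar`, `Δ⋆α = ⋆Δα = 0` by `hodgeLaplacian_hodgeStar`). Warner (1983),
6.1 (4), p. 221; Thm. 6.13 (proof), p. 226. [cite: WarnerGTM94, Thm. 6.13 (proof), p. 226] -/
theorem hodgeStar_mem_harmonicForms_of_isContMDiffRiemannianBundle_holds :
    hodgeStar_mem_harmonicForms_of_isContMDiffRiemannianBundle :=
  fun o ho h _ hα ↦ hodgeStar_mem_harmonicForms_of_mem o ho h _ hα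

end CorrectedFact

/-! ### The fact as declared is false: the rough metric on `ℝ²` -/

section Refutation

open Literature.Geometry.Kaehler.RoughMetric

attribute [local instance] RoughMetric.fact_finrank_real_prod RoughMetric.roughBundle

/-- The constant `1`-form `dy` on the plane `ℝ × ℝ` (the manifold of
`RiemannianHodgeRoughMetric.lean`, carrying the rough metric `a dx² + a⁻¹ dy²` as a local
instance). [folklore] -/
def roughMetricDy : MForm 𝓘(ℝ, ℝ × ℝ) (ℝ × ℝ) ℝ 1 :=
  oneForm fun _ ↦ ContinuousLinearMap.snd ℝ ℝ ℝ

/-- `dy` is a smooth form (it is constant in the identity chart). [folklore] -/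
theorem isSmoothForm_roughMetricDy : IsSmoothForm roughMetricDy := by
  refine isSmoothForm_of_contDiff ?_
  have : flat roughMetricDy = fun _ ↦ DY := rfl
  rw [this]
  exact contDiff_const

/-- `d(dy) = 0` (genuinely: `dy` is constant, `fderiv` of a constant vanishes). [folklore] -/
theorem mextDeriv_roughMetricDy : mextDeriv roughMetricDy = 0 := by
  funext p
  rw [mextDeriv_eq_extDeriv, Pi.zero_apply]
  change ContinuousAlternatingMap.alternatizeUncurryFin (fderiv ℝ (flat roughMetricDy) p) = 0
  have : flat roughMetricDy = fun _ ↦ DY := rfl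
  rw [this, fderiv_const_apply]
  exact map_zero _

/-- `⋆dy = -a dx` is differentiable nowhere (its `dx`-coefficient is `-a`, and the conformal
factor `a` is differentiable at no point; `hodgeStar_oneForm`,
`not_differentiableAt_of_apply_eq`). [folklore] -/
theorem not_differentiableAt_hodgeStar_roughMetricDy (h : 1 + 1 = 2) (p : ℝ × ℝ) :
    ¬ DifferentiableAt ℝ (flat (MForm.hodgeStar stdOrientation h roughMetricDy)) p := by
  rw [roughMetricDy, hodgeStar_oneForm]
  unfold flat
  refine not_differentiableAt_of_apply_eq (c := -1) (by norm_num) (fun q ↦ ?_) p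
  simp

/-- Junk value: `d ⋆ dy = 0`, since `⋆dy` is differentiable nowhere and the `fderiv`-based
exterior derivative vanishes at points of non-differentiability
(`mextDeriv_eq_zero_of_forall_not_differentiableAt`). [folklore] -/
theorem mextDeriv_hodgeStar_roughMetricDy (h : 1 + 1 = 2) :
    mextDeriv (MForm.hodgeStar stdOrientation h roughMetricDy) = 0 :=
  mextDeriv_eq_zero_of_forall_not_differentiableAt (not_differentiableAt_hodgeStar_roughMetricDy h)

/-- **`dy` is (junk-)harmonic for the rough metric**: it is smooth, and
`Δ dy = dδ dy + δd dy = 0` because `d dy = 0` and `δ dy = -⋆(d⋆dy) = -⋆0 = 0`. [folklore] -/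
theorem isHarmonicForm_roughMetricDy (h : 1 + 1 = 2) :
    IsHarmonicForm stdOrientation h roughMetricDy := by
  refine ⟨isSmoothForm_roughMetricDy, ?_⟩
  simp only [hodgeLaplacian, mcoderiv, mextDeriv_roughMetricDy, mextDeriv_hodgeStar_roughMetricDy,
    map_zero, smul_zero, mextDeriv_zero, add_zero]

-- names the `@[deprecated]` record `hodgeStar_mem_harmonicForms` on purpose (verdict clean-up 2026-08-15); REMOVE-WHEN the
-- record is deleted from `L2HodgeTheory.lean`
set_option linter.deprecated false in
/-- **The rough metric violates `hodgeStar_mem_harmonicForms`** (degrees `k = m = 1`,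
dimension `2`): `dy ∈ harmonicForms` (it is harmonic), so the fact would put `⋆dy` in
`harmonicForms`, all of whose elements are smooth (`isSmoothForm_of_mem_harmonicForms`) and in
particular differentiable at the origin as maps `ℝ² → Λ¹` — but `⋆dy = -a dx` is differentiable
nowhere. [folklore] -/
theorem roughMetric_not_hodgeStar_mem_harmonicForms :
    ¬ hodgeStar_mem_harmonicForms (k := 1) (m := 1) stdOrientation := by
  intro hfact
  have h2 : 1 + 1 = 2 := rfl
  have hmem := hfact isSmoothForm_riemannianVolumeForm h2
    (subset_harmonicForms _ h2 (isHarmonicForm_roughMetricDy h2))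
  exact not_differentiableAt_hodgeStar_roughMetricDy h2 0
    (differentiableAt_of_isSmoothForm (isSmoothForm_of_mem_harmonicForms stdOrientation _ hmem) 0)

-- names the `@[deprecated]` record `hodgeStar_mem_harmonicForms` on purpose (verdict clean-up 2026-08-15); REMOVE-WHEN the
-- record is deleted from `L2HodgeTheory.lean`
set_option linter.deprecated false in
/-- **`hodgeStar_mem_harmonicForms` cannot be discharged as stated**: its universal closure over
Riemannian bundle metrics of no regularity is false (witness: `RoughMetric.roughBundle` on
`ℝ × ℝ` with the standard orientation, `roughMetric_not_hodgeStar_mem_harmonicForms`). The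
corrected statement is `hodgeStar_mem_harmonicForms_of_isContMDiffRiemannianBundle`. [folklore] -/
theorem not_forall_hodgeStar_mem_harmonicForms :
    ¬ ∀ (M : Type) [TopologicalSpace M] [ChartedSpace (ℝ × ℝ) M]
        [RiemannianBundle (fun x : M ↦ TangentSpace 𝓘(ℝ, ℝ × ℝ) x)]
        (o : (x : M) → Orientation ℝ (TangentSpace 𝓘(ℝ, ℝ × ℝ) x) (Fin 2)),
        hodgeStar_mem_harmonicForms (k := 1) (m := 1) o :=
  fun hfact ↦ roughMetric_not_hodgeStar_mem_harmonicForms (hfact (ℝ × ℝ) stdOrientation)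

end Refutation

end Literature.NumberTheory.Transcendental
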